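import Literature.MathematicalPhysics.QuantumFieldTheory.PinnedOneLinkLaplaceWords
import Mathlib.Analysis.Normed.Algebra.Exponential
import HarnessLib

/-!
# Preparations for the Morse bounds of the pinned one-link exponent

Third file of the proof of the named fact
`Literature.MathematicalPhysics.QuantumFieldTheory.OneLinkLaplaceConcentration`
(`PinnedOneLinkLaplace.lean`). Elementary inputs of the two-sided quadratic ("Morse") bounds for
the re-centred exponent `Φ(X) = -Re tr(A X) - ε W(X)` of a strongly pinned one-link law at its
minimiser (`PinnedOneLinkLaplaceMorse.lean`):

* `norm_exp_sub_one_le` — the quadratic Taylor bound `‖exp Y - 1 - Y‖ ≤ ‖Y‖² e^{‖Y‖} ≤ 3‖Y‖²`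
  (`‖Y‖ ≤ 1`) in a Banach algebra WITHOUT `‖1‖ = 1` (power series; the tree's
  `QuantumLattice/LieTrotter` version assumes `NormOneClass`, false for `‖·‖_F`);
* `re_trace_eq_of_mem_unitaryGroup` — `Re tr X = N - ½‖X - 1‖_F²` on `U(N)` (the pinning term is
  exactly half the squared chordal distance), `conjTranspose_sub_one` — the inversion identity
  `Xᴴ - 1 = -(X - 1) - (X - 1)(Xᴴ - 1)` on `U(N)` (inversion acts as `-1` to first order),
  `abs_re_trace_word_le` — `|Re tr(word)| ≤ N` for unitary letters;
* `eq_zero_of_forall_abs_le_mul` — the squeeze `(|a| ≤ K t for all small t > 0) ⇒ a = 0`;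
* `abs_sum_le_of_card_le` — sums over the at most `32` words containing the variable link;
* `exists_perturbation_taylor`, `abs_perturbation_sub_le` — the perturbation
  `W(X) = ∑ₘ wₘ Re tr(wordₘ(X))` has a real-linear first-order part `D_W` with
  `|D_W Z| ≤ 32 c₁ ‖Z‖_F`, a remainder `≤ 32 c₂ ‖X - 1‖_F²` on the ball `‖X‖_F ≤ √N`, and
  oscillation `≤ 64 N` on `U(N)` (from `PinnedOneLinkLaplaceWords.exists_word_taylor`).

Matrices carry the Frobenius norm (`open scoped Matrix.Norms.Frobenius`). Everything is proved;
no definitions.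
-/

noncomputable section

open scoped Matrix.Norms.Frobenius Matrix
open Matrix NormedSpace

namespace Literature.MathematicalPhysics.QuantumFieldTheory

/-! ### The quadratic Taylor bound of the exponential -/

section Banach

variable {𝔸 : Type*} [NormedRing 𝔸] [NormedAlgebra ℝ 𝔸] [CompleteSpace 𝔸]

-- adapted from reserve/prior-2001/Prior/QuantumFields/YangMills/Ym_ConfinementFirst_YmCfTrotter.lean
omit [CompleteSpace 𝔸] in
/-- Termwise domination of the exponential series: `‖xⁿ/n!‖ ≤ ‖x‖ⁿ/n!` (`n ≥ 1`; no
`‖1‖ = 1` is assumed). [folklore] -/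
theorem norm_expSeries_term_le (u : 𝔸) {n : ℕ} (hn : 0 < n) :
    ‖((Nat.factorial n : ℝ)⁻¹) • u ^ n‖ ≤ ‖u‖ ^ n / Nat.factorial n := by
  rw [norm_smul, Real.norm_eq_abs, abs_inv, Nat.abs_cast, div_eq_inv_mul]
  exact mul_le_mul_of_nonneg_left (norm_pow_le' u hn) (inv_nonneg.mpr (Nat.cast_nonneg _))

-- adapted from reserve/prior-2001/Prior/QuantumFields/YangMills/Ym_ConfinementFirst_YmCfTrotter.lean
/-- **The quadratic Taylor bound of the exponential** in a real Banach algebra: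
`‖exp u - 1 - u‖ ≤ ‖u‖² e^{‖u‖}` (tail of the power series). [folklore] -/
private theorem norm_exp_sub_one_sub_le (u : 𝔸) :
    ‖exp u - 1 - u‖ ≤ ‖u‖ ^ 2 * Real.exp ‖u‖ := by
  have hsum : Summable fun n : ℕ => ((Nat.factorial n : ℝ)⁻¹) • u ^ n :=
    expSeries_summable' (𝕂 := ℝ) u
  have hsum1 : Summable fun n : ℕ => ((Nat.factorial (n + 1) : ℝ)⁻¹) • u ^ (n + 1) :=
    (_root_.summable_nat_add_iff 1).mpr hsum
  have hsplit : exp u = 1 + u + ∑' n : ℕ, ((Nat.factorial (n + 1 + 1) : ℝ)⁻¹) • u ^ (n + 1 + 1) := by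
    simp only [NormedSpace.exp_eq_tsum (𝕂 := ℝ)]
    rw [hsum.tsum_eq_zero_add, hsum1.tsum_eq_zero_add]
    simp [add_assoc]
  have htail : exp u - 1 - u = ∑' n : ℕ, ((Nat.factorial (n + 1 + 1) : ℝ)⁻¹) • u ^ (n + 1 + 1) := by
    rw [hsplit]; abel
  rw [htail]
  have hnormsum : Summable fun n : ℕ => ‖((Nat.factorial (n + 1 + 1) : ℝ)⁻¹) • u ^ (n + 1 + 1)‖ :=
    (_root_.summable_nat_add_iff 2).mpr (norm_expSeries_summable' (𝕂 := ℝ) u)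
  refine (norm_tsum_le_tsum_norm hnormsum).trans ?_
  have hterm : ∀ n : ℕ, ‖((Nat.factorial (n + 1 + 1) : ℝ)⁻¹) • u ^ (n + 1 + 1)‖
      ≤ ‖u‖ ^ 2 * (‖u‖ ^ n / Nat.factorial n) := by
    intro n
    refine (norm_expSeries_term_le u (by omega : 0 < n + 1 + 1)).trans ?_
    have hfac : (Nat.factorial n : ℝ) ≤ (Nat.factorial (n + 1 + 1) : ℝ) :=
      Nat.cast_le.mpr (Nat.factorial_le (by omega))
    have hfacpos : (0 : ℝ) < (Nat.factorial n : ℝ) := Nat.cast_pos.mpr (Nat.factorial_pos n)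
    have hpow : ‖u‖ ^ (n + 1 + 1) = ‖u‖ ^ 2 * ‖u‖ ^ n := by ring
    rw [hpow, mul_div_assoc]
    gcongr
  refine (hnormsum.tsum_le_tsum hterm
    ((Real.summable_pow_div_factorial ‖u‖).mul_left _)).trans ?_
  rw [tsum_mul_left, Real.exp_eq_exp_ℝ, NormedSpace.exp_eq_tsum_div]

/-- For `‖u‖ ≤ 1`: `‖exp u - 1 - u‖ ≤ 3 ‖u‖²` and `‖exp u - 1‖ ≤ 4 ‖u‖`. [folklore] -/
theorem norm_exp_sub_one_le {u : 𝔸} (hu : ‖u‖ ≤ 1) :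
    ‖exp u - 1 - u‖ ≤ 3 * ‖u‖ ^ 2 ∧ ‖exp u - 1‖ ≤ 4 * ‖u‖ := by
  have he : Real.exp ‖u‖ ≤ 3 := by
    have := Real.exp_one_lt_d9
    have h2 : Real.exp ‖u‖ ≤ Real.exp 1 := Real.exp_le_exp.2 hu
    linarith
  have h1 : ‖exp u - 1 - u‖ ≤ 3 * ‖u‖ ^ 2 := by
    calc ‖exp u - 1 - u‖ ≤ ‖u‖ ^ 2 * Real.exp ‖u‖ := norm_exp_sub_one_sub_le u
      _ ≤ ‖u‖ ^ 2 * 3 := mul_le_mul_of_nonneg_left he (sq_nonneg _)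
      _ = 3 * ‖u‖ ^ 2 := by ring
  refine ⟨h1, ?_⟩
  have h3 : ‖exp u - 1‖ ≤ ‖exp u - 1 - u‖ + ‖u‖ := by
    have := norm_add_le (exp u - 1 - u) u
    rwa [sub_add_cancel] at this
  have h4 : ‖u‖ ^ 2 ≤ ‖u‖ := by
    rw [sq]; exact mul_le_of_le_one_left (norm_nonneg _) hu
  linarith

end Banach

/-! ### Hilbert–Schmidt geometry of `U(N)` -/

variable {N : ℕ}

/-- **The pinning term is half the squared chordal distance**: `Re tr X = N - ½ ‖X - 1‖_F²`
for unitary `X` (Chatterjee, JFA 271 (2016), Lemma 7.2). [folklore] -/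
theorem re_trace_eq_of_mem_unitaryGroup {X : Matrix (Fin N) (Fin N) ℂ}
    (hX : X ∈ Matrix.unitaryGroup (Fin N) ℂ) :
    X.trace.re = N - (1 / 2) * ‖X - 1‖ ^ 2 := by
  have hXX : Xᴴ * X = 1 := by
    have := Matrix.mem_unitaryGroup_iff'.1 hX; rwa [Matrix.star_eq_conjTranspose] at this
  have h : ‖X - 1‖ ^ 2 = ((X - 1)ᴴ * (X - 1)).trace.re := by
    rw [← frobNorm_eq_norm, frobNorm_sq_eq_re_trace]
  have hexp : (X - 1)ᴴ * (X - 1) = 1 + 1 - Xᴴ - X := by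
    rw [Matrix.conjTranspose_sub, Matrix.conjTranspose_one, sub_mul, mul_sub, mul_sub, hXX,
      one_mul, one_mul, mul_one]
    abel
  rw [h, hexp, Matrix.trace_sub, Matrix.trace_sub, Matrix.trace_add, Matrix.trace_one,
    Matrix.trace_conjTranspose, Complex.sub_re, Complex.sub_re, Complex.add_re, Complex.star_def,
    Complex.conj_re]
  simp only [Complex.natCast_re, Fintype.card_fin]
  ring

/-- **Inversion acts as `-1` to first order on `U(N)`**: `Xᴴ - 1 = -(X - 1) - (X - 1)(Xᴴ - 1)`
for unitary `X`. [folklore] -/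
theorem conjTranspose_sub_one {X : Matrix (Fin N) (Fin N) ℂ} (hX : X ∈ Matrix.unitaryGroup (Fin N) ℂ) :
    Xᴴ - 1 = -(X - 1) - (X - 1) * (Xᴴ - 1) := by
  have hXX : X * Xᴴ = 1 := by
    have := Matrix.mem_unitaryGroup_iff.1 hX; rwa [Matrix.star_eq_conjTranspose] at this
  have : (X - 1) * (Xᴴ - 1) = 1 - X - (Xᴴ - 1) := by
    rw [sub_mul, one_mul, mul_sub, hXX, mul_one]
  rw [this]; abel

/-- `‖Xᴴ - 1‖_F = ‖X - 1‖_F`. [folklore] -/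
theorem norm_conjTranspose_sub_one (X : Matrix (Fin N) (Fin N) ℂ) : ‖Xᴴ - 1‖ = ‖X - 1‖ := by
  rw [← norm_conjTranspose' (X - 1), Matrix.conjTranspose_sub, Matrix.conjTranspose_one]

/-- `|Re tr U| ≤ N` for unitary `U` (also `Sweep1AreaLawProofs.abs_re_trace_le_of_mem_unitaryGroup`,
not in the import closure; here by Cauchy–Schwarz). [folklore] -/
private theorem abs_re_trace_unitary_le_card {U : Matrix (Fin N) (Fin N) ℂ}
    (hU : U ∈ Matrix.unitaryGroup (Fin N) ℂ) : |U.trace.re| ≤ N := by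
  have h := abs_re_trace_le_sqrt_mul U
  rw [norm_of_mem_unitaryGroup hU, Real.mul_self_sqrt (Nat.cast_nonneg _)] at h
  exact h

/-- Letters `p.elim (B X) id` are unitary when `B`, `X` and the constants are. [folklore] -/
theorem letter_mem_unitaryGroup {B X : Matrix (Fin N) (Fin N) ℂ} (hB : B ∈ Matrix.unitaryGroup (Fin N) ℂ)
    (hX : X ∈ Matrix.unitaryGroup (Fin N) ℂ) (p : Option (Matrix (Fin N) (Fin N) ℂ))
    (hp : ∀ C, p = some C → C ∈ Matrix.unitaryGroup (Fin N) ℂ) :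
    p.elim (B * X) (fun C => C) ∈ Matrix.unitaryGroup (Fin N) ℂ := by
  cases p with
  | none => exact Submonoid.mul_mem _ hB hX
  | some C => exact hp C rfl

/-- **Words with unitary letters are bounded by `N`**: `|Re tr(ℓ₀ ℓ₁ ℓ₂ᴴ ℓ₃ᴴ)| ≤ N`. [folklore] -/
theorem abs_re_trace_word_le {B X : Matrix (Fin N) (Fin N) ℂ} (hB : B ∈ Matrix.unitaryGroup (Fin N) ℂ)
    (hX : X ∈ Matrix.unitaryGroup (Fin N) ℂ) (p : Fin 4 → Option (Matrix (Fin N) (Fin N) ℂ))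
    (hp : ∀ k C, p k = some C → C ∈ Matrix.unitaryGroup (Fin N) ℂ) :
    |((p 0).elim (B * X) (fun C => C) * (p 1).elim (B * X) (fun C => C) *
        ((p 2).elim (B * X) (fun C => C))ᴴ * ((p 3).elim (B * X) (fun C => C))ᴴ).trace.re| ≤ N := by
  refine abs_re_trace_unitary_le_card ?_
  have hl := fun k => letter_mem_unitaryGroup hB hX (p k) (hp k)
  have hs : ∀ k, ((p k).elim (B * X) (fun C => C))ᴴ ∈ Matrix.unitaryGroup (Fin N) ℂ := fun k => by
    rw [← Matrix.star_eq_conjTranspose]; exact Unitary.star_mem (hl k)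
  exact Submonoid.mul_mem _ (Submonoid.mul_mem _ (Submonoid.mul_mem _ (hl 0) (hl 1)) (hs 2)) (hs 3)

/-! ### Two elementary real lemmas -/

/-- **Squeeze**: if `|a| ≤ K t` for all `0 < t ≤ t₀` then `a = 0`. [folklore] -/
theorem eq_zero_of_forall_abs_le_mul {a K t₀ : ℝ} (hK : 0 ≤ K) (ht₀ : 0 < t₀)
    (h : ∀ t, 0 < t → t ≤ t₀ → |a| ≤ K * t) : a = 0 := by
  by_contra ha
  have ha' : 0 < |a| := abs_pos.2 ha
  set t := min t₀ (|a| / (2 * (K + 1))) with ht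
  have ht1 : 0 < t := lt_min ht₀ (by positivity)
  have ht2 : t ≤ t₀ := min_le_left _ _
  have ht3 : t ≤ |a| / (2 * (K + 1)) := min_le_right _ _
  have := h t ht1 ht2
  have hKt : K * t ≤ K * (|a| / (2 * (K + 1))) := mul_le_mul_of_nonneg_left ht3 hK
  have : K * (|a| / (2 * (K + 1))) < |a| := by
    rw [mul_div_assoc', div_lt_iff₀ (by positivity)]
    nlinarith
  linarith

/-- **Sums over the words containing the variable link.** If `g m = 0` unless word `m` contains
the variable letter, `|g m| ≤ c` always, and at most `32` words contain the variable letter, then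
`|∑ₘ g m| ≤ 32 c`. [folklore] -/
theorem abs_sum_le_of_card_le {Λ : Type*} [Fintype Λ] {α : Type*} {p : Λ → Fin 4 → Option α}
    (hT : ∀ T : Finset Λ, (∀ m ∈ T, ∃ k, p m k = none) → T.card ≤ 32)
    {g : Λ → ℝ} {c : ℝ} (hc : 0 ≤ c) (hg0 : ∀ m, (∀ k, p m k ≠ none) → g m = 0)
    (hgc : ∀ m, |g m| ≤ c) : |∑ m, g m| ≤ 32 * c := by
  classical
  set T := Finset.univ.filter (fun m : Λ => ∃ k, p m k = none) with hTdef
  have hsub : ∑ m, g m = ∑ m ∈ T, g m := by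
    refine (Finset.sum_subset (Finset.filter_subset _ _) fun m _ hm => ?_).symm
    refine hg0 m fun k hk => hm ?_
    exact Finset.mem_filter.2 ⟨Finset.mem_univ _, k, hk⟩
  have hcard : T.card ≤ 32 := hT T fun m hm => (Finset.mem_filter.1 hm).2
  rw [hsub]
  calc |∑ m ∈ T, g m| ≤ ∑ m ∈ T, |g m| := Finset.abs_sum_le_sum_abs _ _
    _ ≤ ∑ _m ∈ T, c := Finset.sum_le_sum fun m _ => hgc m
    _ = T.card * c := by rw [Finset.sum_const, nsmul_eq_mul]
    _ ≤ 32 * c := mul_le_mul_of_nonneg_right (by exact_mod_cast hcard) hc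

/-! ### The perturbation `W(X) = ∑ₘ wₘ Re tr(wordₘ(X))` -/

/-- A word all of whose letters are constant does not depend on `X`. [folklore] -/
theorem word_eq_of_forall_ne_none {B X X' : Matrix (Fin N) (Fin N) ℂ}
    {p : Fin 4 → Option (Matrix (Fin N) (Fin N) ℂ)} (hp : ∀ k, p k ≠ none) :
    ((p 0).elim (B * X) (fun C => C) * (p 1).elim (B * X) (fun C => C) *
        ((p 2).elim (B * X) (fun C => C))ᴴ * ((p 3).elim (B * X) (fun C => C))ᴴ).trace.re =
    ((p 0).elim (B * X') (fun C => C) * (p 1).elim (B * X') (fun C => C) *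
        ((p 2).elim (B * X') (fun C => C))ᴴ * ((p 3).elim (B * X') (fun C => C))ᴴ).trace.re := by
  obtain ⟨C₀, h₀⟩ := Option.ne_none_iff_exists'.1 (hp 0)
  obtain ⟨C₁, h₁⟩ := Option.ne_none_iff_exists'.1 (hp 1)
  obtain ⟨C₂, h₂⟩ := Option.ne_none_iff_exists'.1 (hp 2)
  obtain ⟨C₃, h₃⟩ := Option.ne_none_iff_exists'.1 (hp 3)
  simp [h₀, h₁, h₂, h₃]

/-- **First-order structure of the perturbation.** With the uniform word expansion of
`PinnedOneLinkLaplaceWords.exists_word_taylor` (constants `c₁, c₂`), weights `|wₘ| ≤ 1` and at most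
`32` words containing the variable link, `W(X) = ∑ₘ wₘ Re tr(wordₘ(X))` satisfies
`W(X) - W(1) = D_W(X - 1) + R_W(X)` with real-linear `D_W`, `|D_W Z| ≤ 32 c₁ ‖Z‖_F` and
`|R_W(X)| ≤ 32 c₂ ‖X - 1‖_F²` on `‖X‖_F ≤ √N`. [folklore] -/
theorem exists_perturbation_taylor {Λ : Type*} [Fintype Λ] {c₁ c₂ : ℝ} (hc₁ : 0 ≤ c₁) (hc₂ : 0 ≤ c₂)
    {B : Matrix (Fin N) (Fin N) ℂ} (w : Λ → ℝ) (hw : ∀ m, |w m| ≤ 1) (p : Λ → Fin 4 → Option (Matrix (Fin N) (Fin N) ℂ))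
    (hp : ∀ m k C, p m k = some C → C ∈ Matrix.unitaryGroup (Fin N) ℂ)
    (hT : ∀ T : Finset Λ, (∀ m ∈ T, ∃ k, p m k = none) → T.card ≤ 32)
    (hword : ∀ p' : Fin 4 → Option (Matrix (Fin N) (Fin N) ℂ),
      (∀ k C, p' k = some C → C ∈ Matrix.unitaryGroup (Fin N) ℂ) →
      ∃ D : Matrix (Fin N) (Fin N) ℂ →ₗ[ℝ] ℝ, (∀ Z, |D Z| ≤ c₁ * ‖Z‖) ∧
        ∀ X, ‖X‖ ≤ Real.sqrt N →
          |((p' 0).elim (B * X) (fun C => C) * (p' 1).elim (B * X) (fun C => C) *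
              ((p' 2).elim (B * X) (fun C => C))ᴴ * ((p' 3).elim (B * X) (fun C => C))ᴴ).trace.re -
            ((p' 0).elim (B * 1) (fun C => C) * (p' 1).elim (B * 1) (fun C => C) *
              ((p' 2).elim (B * 1) (fun C => C))ᴴ * ((p' 3).elim (B * 1) (fun C => C))ᴴ).trace.re -
            D (X - 1)| ≤ c₂ * ‖X - 1‖ ^ 2) :
    ∃ DW : Matrix (Fin N) (Fin N) ℂ →ₗ[ℝ] ℝ, (∀ Z, |DW Z| ≤ 32 * c₁ * ‖Z‖) ∧
      ∀ X, ‖X‖ ≤ Real.sqrt N →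
        |∑ m, w m * ((p m 0).elim (B * X) (fun C => C) * (p m 1).elim (B * X) (fun C => C) *
              ((p m 2).elim (B * X) (fun C => C))ᴴ * ((p m 3).elim (B * X) (fun C => C))ᴴ).trace.re -
          ∑ m, w m * ((p m 0).elim (B * 1) (fun C => C) * (p m 1).elim (B * 1) (fun C => C) *
              ((p m 2).elim (B * 1) (fun C => C))ᴴ * ((p m 3).elim (B * 1) (fun C => C))ᴴ).trace.re -
          DW (X - 1)| ≤ 32 * c₂ * ‖X - 1‖ ^ 2 := by
  classical
  choose D hD1 hD2 using fun m => hword (p m) (hp m)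
  set D' : Λ → Matrix (Fin N) (Fin N) ℂ →ₗ[ℝ] ℝ := fun m => if ∃ k, p m k = none then D m else 0
    with hD'
  refine ⟨∑ m, w m • D' m, fun Z => ?_, fun X hX => ?_⟩
  · rw [LinearMap.sum_apply]
    simp only [LinearMap.smul_apply, smul_eq_mul]
    have := abs_sum_le_of_card_le hT (c := c₁ * ‖Z‖) (by positivity)
      (g := fun m => w m * D' m Z) (fun m hm => by
        have : ¬ ∃ k, p m k = none := fun ⟨k, hk⟩ => hm k hk
        simp [hD', this]) (fun m => by
        rw [abs_mul]
        by_cases h : ∃ k, p m k = none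
        · simp only [hD', h, ↓reduceIte]
          calc |w m| * |D m Z| ≤ 1 * (c₁ * ‖Z‖) :=
                mul_le_mul (hw m) (hD1 m Z) (abs_nonneg _) zero_le_one
            _ = c₁ * ‖Z‖ := one_mul _
        · simp only [hD', h, ↓reduceIte, LinearMap.zero_apply, abs_zero, mul_zero]
          positivity)
    linarith
  · rw [LinearMap.sum_apply, ← Finset.sum_sub_distrib, ← Finset.sum_sub_distrib]
    simp only [LinearMap.smul_apply, smul_eq_mul, ← mul_sub]
    have := abs_sum_le_of_card_le hT (c := c₂ * ‖X - 1‖ ^ 2) (by positivity)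
      (g := fun m => w m * (((p m 0).elim (B * X) (fun C => C) * (p m 1).elim (B * X) (fun C => C) *
              ((p m 2).elim (B * X) (fun C => C))ᴴ * ((p m 3).elim (B * X) (fun C => C))ᴴ).trace.re -
          ((p m 0).elim (B * 1) (fun C => C) * (p m 1).elim (B * 1) (fun C => C) *
              ((p m 2).elim (B * 1) (fun C => C))ᴴ * ((p m 3).elim (B * 1) (fun C => C))ᴴ).trace.re -
          D' m (X - 1)))
      (fun m hm => by
        have hne : ¬ ∃ k, p m k = none := fun ⟨k, hk⟩ => hm k hk
        simp only [hD', hne, ↓reduceIte, LinearMap.zero_apply, sub_zero]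
        rw [word_eq_of_forall_ne_none (X := X) (X' := 1) hm, sub_self, mul_zero])
      (fun m => by
        rw [abs_mul]
        by_cases h : ∃ k, p m k = none
        · simp only [hD', h, ↓reduceIte]
          calc _ ≤ 1 * (c₂ * ‖X - 1‖ ^ 2) :=
                mul_le_mul (hw m) (hD2 m X hX) (abs_nonneg _) zero_le_one
            _ = c₂ * ‖X - 1‖ ^ 2 := one_mul _
        · have hne : ∀ k, p m k ≠ none := fun k hk => h ⟨k, hk⟩
          simp only [hD', h, ↓reduceIte, LinearMap.zero_apply, sub_zero]
          rw [word_eq_of_forall_ne_none (X := X) (X' := 1) hne, sub_self, abs_zero, mul_zero]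
          positivity)
    linarith

/-- `|x| ≤ 1`, `|a|, |b| ≤ n` give `|x| |a - b| ≤ 2n`. [folklore] -/
theorem abs_mul_abs_sub_le {x a b n : ℝ} (hx : |x| ≤ 1) (ha : |a| ≤ n) (hb : |b| ≤ n) :
    |x| * |a - b| ≤ 2 * n := by
  have h := abs_sub a b
  nlinarith [abs_nonneg x, abs_nonneg (a - b)]

/-- **Oscillation of the perturbation on `U(N)`**: `|W(X) - W(X')| ≤ 64 N` for unitary `X, X'`
(only the at most `32` words containing the variable link change, each by at most `2N`). [folklore] -/
theorem abs_perturbation_sub_le {Λ : Type*} [Fintype Λ]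
    {B : Matrix (Fin N) (Fin N) ℂ} (hB : B ∈ Matrix.unitaryGroup (Fin N) ℂ)
    (w : Λ → ℝ) (hw : ∀ m, |w m| ≤ 1) (p : Λ → Fin 4 → Option (Matrix (Fin N) (Fin N) ℂ))
    (hp : ∀ m k C, p m k = some C → C ∈ Matrix.unitaryGroup (Fin N) ℂ)
    (hT : ∀ T : Finset Λ, (∀ m ∈ T, ∃ k, p m k = none) → T.card ≤ 32)
    {X X' : Matrix (Fin N) (Fin N) ℂ} (hX : X ∈ Matrix.unitaryGroup (Fin N) ℂ)
    (hX' : X' ∈ Matrix.unitaryGroup (Fin N) ℂ) :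
    |∑ m, w m * ((p m 0).elim (B * X) (fun C => C) * (p m 1).elim (B * X) (fun C => C) *
          ((p m 2).elim (B * X) (fun C => C))ᴴ * ((p m 3).elim (B * X) (fun C => C))ᴴ).trace.re -
      ∑ m, w m * ((p m 0).elim (B * X') (fun C => C) * (p m 1).elim (B * X') (fun C => C) *
          ((p m 2).elim (B * X') (fun C => C))ᴴ * ((p m 3).elim (B * X') (fun C => C))ᴴ).trace.re|
      ≤ 64 * N := by
  rw [← Finset.sum_sub_distrib]
  simp only [← mul_sub]
  have := abs_sum_le_of_card_le hT (c := 2 * N) (by positivity)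
    (g := fun m => w m * (((p m 0).elim (B * X) (fun C => C) * (p m 1).elim (B * X) (fun C => C) *
          ((p m 2).elim (B * X) (fun C => C))ᴴ * ((p m 3).elim (B * X) (fun C => C))ᴴ).trace.re -
      ((p m 0).elim (B * X') (fun C => C) * (p m 1).elim (B * X') (fun C => C) *
          ((p m 2).elim (B * X') (fun C => C))ᴴ * ((p m 3).elim (B * X') (fun C => C))ᴴ).trace.re))
    (fun m hm => by rw [word_eq_of_forall_ne_none (X := X) (X' := X') hm, sub_self, mul_zero])
    (fun m => by
      rw [abs_mul]
      exact abs_mul_abs_sub_le (hw m) (abs_re_trace_word_le hB hX (p m) (hp m))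
        (abs_re_trace_word_le hB hX' (p m) (hp m)))
  linarith

end Literature.MathematicalPhysics.QuantumFieldTheory

end
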